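import Literature.Barriers.PneNP.MCSPHardnessObstructionsPadding
import Literature.Computability.MetaComplexity.DistProblemsProofs
import Literature.Computability.Complexity.FinitePatching
import Literature.Computability.Complexity.LengthCompare
import Literature.Computability.Complexity.DTIMESubsetNTIME
import Literature.Computability.Complexity.BPPErrorReduction
import Literature.Computability.Complexity.CountingHierarchyProofs
import Literature.Computability.Complexity.UnaryBricks
import Literature.Computability.Complexity.ToranCounting
import HarnessLib

/-!
# Average-case easiness of `NP` collapses `NE` to `E` (Ben-David–Chor–Goldreich–Luby; BFP Thm. 3.5)

Topic `Literature/Computability/MetaComplexity`, companion to `DistProblems.lean` (`DistNP`, `AvgP`)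
and to `AvgCaseDerandomization.lean` / `AvgCaseDerandomizationProofs.lean` (Buhrman–Fortnow–Pavan's
Thm. 3.1, `DistNP ⊆ AvgP ⟹ Promise-BPP = Promise-P`, one of the two remaining leaves of Hirahara's
Cor. 4.23, `GapMINKT.lean`). This file PROVES the third ingredient of BFP's proof of Thm. 3.1:

> **Theorem 3.5 (BCGL).** *If `NP` is easy on average then `E = NE`.* "The idea of the proof uses
> a `μ′` that puts enough measure on the tally strings such that any algorithm that is polynomial on
> `μ`-average should take polynomial-time on all the tally strings. Hence the tally sets in `NP` are
> in `P` which implies that `E = NE`." (Buhrman–Fortnow–Pavan 2005, p. 5, citing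
> Ben-David–Chor–Goldreich–Luby 1992.)

Main results (hypothesis `DistNP ⊆ AvgP` in the library's Bogdanov–Trevisan conventions, as in
`AvgCaseDerandomization.lean`; `E`, `NE` of `Classes.lean` / `Nondeterministic.lean`):

* `NTIME_two_pow_mul_subset_E_of_DistNP_subset_AvgP` — `DistNP ⊆ AvgP ⟹ NTIME(2^{an}) ⊆ E` (`1 ≤ a`);
* **`NE_subset_E_of_DistNP_subset_AvgP`**, **`E_eq_NE_of_DistNP_subset_AvgP`** — `DistNP ⊆ AvgP ⟹
  E = NE`; with the unconditional `E_subset_NE` and the bookkeeping inclusion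
  `NTIME_one_subset_NTIME_two_pow` (the member `c = 0` of `NE = ⋃_c NTIME(2^{cn})`).

## Proof

The printed idea, with the sparse padded language in place of the tally set (so that no coding of
words by numbers is needed; translation by padding, Arora–Barak 2009, §2.6.2):

* (A, `AvgNE.exists_pad_mem_NP`) for `L ∈ NTIME(2^{an})`, `a ≥ 1`, the pads `lpad a x = ⟨1^{2^{a|x|}} 0
  1^{a|x|}, x⟩` (`ExpTimeMaps.lean`) of the members of `L` form an `NP` language `L♯`, all of whose
  members are well-formed pads — the generalisation to the exponent `a` of
  `KarpAssembly.exists_sparse_pad_mem_NP` (`Barriers/PneNP/MCSPHardnessObstructionsPadding.lean`,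
  Murray–Williams' sparse `NP` pad of an `NTIME(2ⁿ)` language), with a polynomial-time clock
  (`AvgNE.clockF`) feeding the truncating wrapper `truncMapAux` of `TruncMapMachine.lean`;
* (B, `AvgNE.padEnsemble_mem_PSamp`, `AvgNE.prob_padEnsemble_lpad`) the ensemble `D^{(a)}` whose `N`-th
  member is the pad of a uniformly random payload of the length `n` with `|lpad a x| = N` is
  polynomial-time samplable (it is DEFINED as the output ensemble of the sampler `AvgNE.sampler`, an
  `FP` string function), and gives each such pad, `n ≥ 4`, probability exactly `2⁻ⁿ`;
* (C/D) hence the errorless heuristic scheme of `(L♯, D^{(a)}) ∈ DistNP ⊆ AvgP`, run at index `N` with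
  error parameter `m = 2^{n+1}` (failure probability `≤ 2^{-n-1} < 2⁻ⁿ`), does not fail on any pad of
  a payload of length `≥ 4` and, being errorless on the support, answers `[x ∈ L]`; the pads it
  accepts form a language in `P` (`AvgNE.setOf_scheme_accepts_mem_P`), which after patching the
  finitely many short payload lengths has preimage `L` under the `2^{O(n)}`-time pad, so `L ∈ E`
  (`preimage_mem_E`, `ExpTimeMaps.lean`).

## References

* H. Buhrman, L. Fortnow, A. Pavan, *Some results on derandomization*, Theory Comput. Syst. 38
  (2005) 211–227, Thm. 3.5 and the proof idea printed after it (authors' version, p. 5)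
  [BuhrmanFortnowPavan2004] (text checked).
* S. Ben-David, B. Chor, O. Goldreich, M. Luby, *On the theory of average case complexity*,
  J. Comput. Syst. Sci. 44 (1992) 193–219 (the origin of Thm. 3.5, as cited by BFP).
* A. Bogdanov, L. Trevisan, *Average-case complexity*, Found. Trends TCS 2 (2006), Def. 2.1, 2.4
  [BogdanovTrevisan2006].
* S. Arora, B. Barak, *Computational Complexity: A Modern Approach*, CUP 2009, §2.6.2 (padding,
  Thm. 2.22), Claim 2.4, §1.3 [AroraBarakCC2009].

## Design notes

* No definition of mathematical content and no named fact is introduced: the bricks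
  (`AvgNE.pow2NumF`, `boundF`, `clockF`, `nOfU`, `selF`, `sampF`, `mF`, `preF`), the sampler and its
  ensemble are proof devices of this file.
* The payload length is read off the pad length as `(⌊log₂ N⌋ - 1)/a` (`AvgNE.nOf_length_lpad`,
  valid for payloads of length `≥ 4`); shorter payloads are patched at the level of pads, whose
  length is strictly monotone in the payload length (`AvgNE.strictMono_length_lpad`).
-/

noncomputable section

namespace Literature.Computability.MetaComplexity

open _root_.Computability Turing Polynomial Complexity Complexity.PairFstTM Brick Plumb Nondeterministic
  Literature.Barriers.PneNP Literature.Barriers.PneNP.KarpAssembly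

namespace AvgNE

/-! ### A. Pads of `NTIME(2^{an})` languages are `NP` languages -/

section PadNP

variable (a c : ℕ)

/-- The numeral of `2^{a|x|}`: `0^{a|x|} 1`. [folklore] -/
def pow2NumF : List Bool → List Bool := fun x => Kannan.zerosFn (onesMulFn a x) ++ [true]

/-- `pow2NumF a ∈ FP`. [folklore] -/
theorem pow2NumF_mem_FP : pow2NumF a ∈ FP :=
  append_mem_FP (comp_mem_FP Kannan.zerosFn_mem_FP (onesMulFn_mem_FP a)) (const_mem_FP [true])

/-- Value of the numeral: `⟦pow2NumF a x⟧ = 2^{a|x|}`. [folklore] -/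
theorem bitsToNat_pow2NumF (x : List Bool) : bitsToNat (pow2NumF a x) = 2 ^ (a * x.length) := by
  simp [pow2NumF, onesMulFn, bitsToNat_append_true]

/-- **The witness bound in unary**, `w ↦ 1^{c · 2^{a|x|} + c}` with `x = logTruncFn w`, computed
through the capped binary-to-unary conversion (the cap `(2|w|+2)^a` never bites, `2^{a|x|} ≤ (2|w|+2)^a`).
[folklore] -/
def boundF : List Bool → List Bool :=
  polyFn (Polynomial.C c * X + Polynomial.C c) ∘ binToUnaryFn ∘
    fanoutFn (polyFn ((2 * X + 2) ^ a)) (pow2NumF a ∘ logTruncFn)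

/-- `boundF a c ∈ FP`. [folklore] -/
theorem boundF_mem_FP : boundF a c ∈ FP :=
  comp_mem_FP (polyFn_mem_FP _) (comp_mem_FP binToUnaryFn_mem_FP
    (fanoutFn_mem_FP (polyFn_mem_FP _) (comp_mem_FP (pow2NumF_mem_FP a) logTruncFn_mem_FP)))

/-- `2^{a |logTruncFn w|} ≤ (2|w| + 2)^a`. [folklore] -/
theorem two_pow_mul_length_logTruncFn_le (w : List Bool) :
    2 ^ (a * (logTruncFn w).length) ≤ (2 * w.length + 2) ^ a :=
  (Nat.pow_le_pow_right Nat.two_pos (Nat.mul_le_mul_left a (length_logTruncFn_le w))).trans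
    (two_pow_mul_log_succ_le a w.length)

/-- Value of the bound: `boundF a c w = 1^{c · 2^{a|logTruncFn w|} + c}`. [folklore] -/
theorem boundF_apply (w : List Bool) :
    boundF a c w = ones (c * 2 ^ (a * (logTruncFn w).length) + c) := by
  have hmin : min (2 ^ (a * (logTruncFn w).length)) ((2 * w.length + 2) ^ a) =
      2 ^ (a * (logTruncFn w).length) := min_eq_left (two_pow_mul_length_logTruncFn_le a w)
  simp [boundF, Function.comp_apply, fanoutFn_apply, binToUnaryFn_boolPair,
    bitsToNat_pow2NumF, ones, hmin]

/-- **The clock of the verifier**: `w ↦ ⟨x, 1^{c·2^{a|x|}+c}⟩`, `x = logTruncFn w`. [folklore] -/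
def clockF : List Bool → List Bool := fanoutFn logTruncFn (boundF a c)

/-- `clockF a c ∈ FP`. [folklore] -/
theorem clockF_mem_FP : clockF a c ∈ FP := fanoutFn_mem_FP logTruncFn_mem_FP (boundF_mem_FP a c)

/-- Value of the clock. [folklore] -/
theorem clockF_apply (w : List Bool) :
    clockF a c w = boolPair (logTruncFn w) (ones (c * 2 ^ (a * (logTruncFn w).length) + c)) := by
  rw [clockF, fanoutFn_apply, boundF_apply]

/-- Some machine computes the clock within polynomially many steps. [folklore] -/
theorem exists_clock_machine :
    ∃ (q : Polynomial ℕ) (N : TM2ComputableAux Bool Bool), ∀ w : List Bool,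
      N.OutputsWithin w (boolPair (logTruncFn w) (ones (c * 2 ^ (a * (logTruncFn w).length) + c)))
        (q.eval w.length) := by
  obtain ⟨q, N, hN⟩ := clockF_mem_FP a c
  refine ⟨q, N, fun w => ?_⟩
  have h := hN w
  rw [clockF_apply] at h
  exact h

variable {a}

/-- **`L ∈ NTIME(2^{an}) ⇒ logTruncLang L ∈ NP`** (`1 ≤ a`; the case `a = 1` is
`KarpAssembly.logTruncLang_mem_NP`). Let `(c, R, M)` present `L`. The witness language is
`V = {u | R x ((readRest u) ↾ B) = 1}` with `x = logTruncFn (fst u)`, `B = c · 2^{a|x|} + c`: it is in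
`P`, decided by the truncating wrapper `truncMapAux` of the clock `fst u ↦ ⟨x, 1^B⟩` followed by `M`,
which on such an admissible pair halts within `B ≤ c (2|u| + 2)^a + c` steps. Correctness:
`w ∈ logTruncLang L ↔ x ∈ L ↔ ∃ y, |y| ≤ B ∧ R x y = 1`, and such `y` are exactly the kept parts
of witnesses of length `≤ c(2|w|+2)^a + c`. [cite: AroraBarakCC2009, §2.6.2 (Thm. 2.22, padding)] -/
theorem logTruncLang_mem_NP {L : Language Bool} (hL : L ∈ NTIME (fun n => 2 ^ (a * n))) :
    logTruncLang L ∈ NP := by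
  obtain ⟨c, R, M, hM, hLR⟩ := hL
  obtain ⟨q, Nc, hNc⟩ := exists_clock_machine a c
  -- the witness language, through its defining equation
  obtain ⟨V, hV⟩ : ∃ V : Language Bool, V = {u | R (logTruncFn (boolUnpair u).1)
      ((readRest u).take (c * 2 ^ (a * (logTruncFn (boolUnpair u).1).length) + c)) = true} :=
    ⟨_, rfl⟩
  have hmemV : ∀ u : List Bool, u ∈ V ↔ R (logTruncFn (boolUnpair u).1)
      ((readRest u).take (c * 2 ^ (a * (logTruncFn (boolUnpair u).1).length) + c)) = true :=
    fun u => by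
    rw [hV]
    exact Iff.rfl
  -- `V ∈ P`: truncate the witness, then run `M`
  have hVP : V ∈ Classes.P := by
    refine timeClass_subset_P_of_polynomial_holds
      (q + Polynomial.C (3 * c) * (2 * X + 2) ^ a + 5 * X + Polynomial.C (3 * c + 12)) ?_
    refine ⟨(truncMapAux Nc).comp M, fun u => ?_⟩
    have hclock := hNc (boolUnpair u).1
    have h₁ := outputsWithin_truncMapAux Nc (z := u) hclock
    simp only [List.length_replicate] at h₁
    have hy' : ((readRest u).take (c * 2 ^ (a * (logTruncFn (boolUnpair u).1).length) + c)).length ≤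
        c * 2 ^ (a * (logTruncFn (boolUnpair u).1).length) + c := List.length_take_le _ _
    have h₂ := hM (logTruncFn (boolUnpair u).1) _ hy'
    have h := TM2ComputableAux.comp_outputsWithin _ _ h₁ h₂
    have hind : R (logTruncFn (boolUnpair u).1)
        ((readRest u).take (c * 2 ^ (a * (logTruncFn (boolUnpair u).1).length) + c)) =
          V.boolIndicator u := by
      rw [Bool.eq_iff_iff]
      exact ⟨fun h => (Set.mem_iff_boolIndicator _ _).1 ((hmemV u).2 h),
        fun h => (hmemV u).1 ((Set.mem_iff_boolIndicator _ _).2 h)⟩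
    rw [hind] at h
    refine h.mono ?_
    -- the estimates, all polynomial in `|u|`
    have hwu : (boolUnpair u).1.length ≤ u.length := length_boolUnpair_fst_le u
    have hx : (logTruncFn (boolUnpair u).1).length ≤ (boolUnpair u).1.length + 1 :=
      (length_logTruncFn_le _).trans (Nat.succ_le_succ (Nat.log_le_self 2 _))
    have hpow : 2 ^ (a * (logTruncFn (boolUnpair u).1).length) ≤ (2 * u.length + 2) ^ a :=
      (two_pow_mul_length_logTruncFn_le a _).trans (Nat.pow_le_pow_left (by omega) a)
    have hr : (readRest u).length ≤ u.length := by
      have := readSteps_add_le u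
      have := one_le_readSteps u
      omega
    have hsub : u.length - (readRest u).length ≤ u.length := Nat.sub_le _ _
    have hdiv : (readRest u).length / 2 ≤ u.length := (Nat.div_le_self _ _).trans hr
    have hq : q.eval (boolUnpair u).1.length ≤ q.eval u.length := TM2Iter.eval_mono q hwu
    have e1 : c * 2 ^ (a * (logTruncFn (boolUnpair u).1).length) ≤ c * (2 * u.length + 2) ^ a :=
      Nat.mul_le_mul_left c hpow
    simp only [id, eval_add, eval_mul, eval_C, eval_X, eval_pow, eval_ofNat]
    linarith [e1, hq, hx, hwu, hsub, hdiv, Nat.zero_le (c * (2 * u.length + 2) ^ a)]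
  -- the `NP` presentation
  refine ⟨V, hVP, Polynomial.C c * (2 * X + 2) ^ a + Polynomial.C c, fun w => ?_⟩
  have hmem : ∀ y : List Bool, boolPair w y ∈ V ↔
      R (logTruncFn w) (y.take (c * 2 ^ (a * (logTruncFn w).length) + c)) = true := fun y => by
    simp only [hmemV, boolUnpair_boolPair, readRest_boolPair]
  have hB : c * 2 ^ (a * (logTruncFn w).length) + c ≤ c * (2 * w.length + 2) ^ a + c :=
    Nat.add_le_add_right (Nat.mul_le_mul_left c (two_pow_mul_length_logTruncFn_le a w)) c
  change logTruncFn w ∈ L ↔ _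
  rw [hLR (logTruncFn w)]
  simp only [eval_add, eval_mul, eval_C, eval_X, eval_pow, eval_ofNat]
  constructor
  · rintro ⟨y, hy, hRy⟩
    refine ⟨y, hy.trans hB, (hmem y).2 ?_⟩
    rwa [List.take_of_length_le hy]
  · rintro ⟨y, -, hy⟩
    exact ⟨_, List.length_take_le _ _, (hmem y).1 hy⟩

variable (a)

/-- **Re-padding the truncation is polynomial time**: `lpad a ∘ logTruncFn ∈ FP` (the pad runs in
time `K · 2^{c n} + K` on a word of length `n ≤ log₂ N + 1`; the case `a = 1` is
`KarpAssembly.lpad_comp_logTruncFn_mem_FP`). [cite: AroraBarakCC2009, §1.3 (Claim 1.6)] -/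
theorem lpad_comp_logTruncFn_mem_FP : lpad a ∘ logTruncFn ∈ FP := by
  obtain ⟨c, K, hK⟩ := mem_FE_iff.1 (lpad_mem_FE a)
  obtain ⟨p, hp⟩ := logTruncFn_mem_FP
  obtain ⟨C, hC⟩ := TimeComputable.comp_holds hK hp (monotone_expLin c K)
    (s := fun N => Nat.log 2 N + 1) length_logTruncFn_le
  refine ⟨Polynomial.C C * (p + (Polynomial.C K * (2 * X + 2) ^ c + Polynomial.C K) + (X + 1)) +
    Polynomial.C C, hC.mono fun N => ?_⟩
  have h1 := two_pow_mul_log_succ_le c N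
  have h2 : Nat.log 2 N ≤ N := Nat.log_le_self 2 N
  simp only [eval_add, eval_mul, eval_C, eval_X, eval_pow, eval_ofNat, eval_one]
  gcongr

/-- **The well-formed pads `{w | lpad a (logTruncFn w) = w}` form a language in `P`** (equality
test of two `FP` maps). [folklore] -/
theorem padFmt_mem_P : ({w | lpad a (logTruncFn w) = w} : Language Bool) ∈ Classes.P := by
  have h := setOf_apply_eq_apply_mem_P (lpad_comp_logTruncFn_mem_FP a) OracleCompose.id_mem_FP
  simpa only [Function.comp_apply, id_eq] using h

variable {a}

/-- Pads are well formed: `lpad a x ∈ PadFmt` (`1 ≤ a`). [folklore] -/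
theorem lpad_mem_padFmt (ha : 1 ≤ a) (x : List Bool) :
    lpad a x ∈ ({w | lpad a (logTruncFn w) = w} : Language Bool) := by
  change lpad a (logTruncFn (lpad a x)) = lpad a x
  rw [logTruncFn_lpad ha]

/-- **The `NP` pad of an `NTIME(2^{an})` language** (`1 ≤ a`): there is `L♯ ∈ NP`, all of whose
members are well-formed pads, with `x ∈ L ↔ lpad a x ∈ L♯` (namely
`L♯ = PadFmt ⊓ logTruncLang L = {lpad a x | x ∈ L}`; translation downward by padding,
Arora–Barak 2009, §2.6.2; Book 1974). [cite: AroraBarakCC2009, §2.6.2 (Thm. 2.22)] -/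
theorem exists_pad_mem_NP (ha : 1 ≤ a) {L : Language Bool} (hL : L ∈ NTIME (fun n => 2 ^ (a * n))) :
    ∃ Lp : Language Bool, Lp ∈ NP ∧ (∀ x : List Bool, x ∈ L ↔ lpad a x ∈ Lp) ∧
      ∀ w ∈ Lp, lpad a (logTruncFn w) = w := by
  refine ⟨{w | lpad a (logTruncFn w) = w} ⊓ logTruncLang L, ?_, fun x => ?_, fun w hw => hw.1⟩
  · exact inter_P_mem_polyExists (fun _ _ h₁ h₂ => inter_mem_P h₁ h₂) (padFmt_mem_P a)
      (logTruncLang_mem_NP hL)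
  · change x ∈ L ↔ lpad a x ∈ ({w | lpad a (logTruncFn w) = w} : Language Bool) ∧
      lpad a x ∈ logTruncLang L
    rw [lpad_mem_logTruncLang_iff ha]
    exact ⟨fun hx => ⟨lpad_mem_padFmt ha x, hx⟩, fun h => h.2⟩

end PadNP

/-! ### B. The samplable ensemble of pads -/

section Sampler

variable (a : ℕ)

/-- The payload length of a pad, read off the pad length in unary:
`u ↦ 1^{(⌊log₂ |u|⌋ - 1) / a}` (for `|u| = |lpad a x|`, `|x| ≥ 4`, this is `1^{|x|}`,
`nOf_length_lpad`). [folklore] -/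
def nOfU : List Bool → List Bool :=
  fstF ∘ divModFn ∘ fanoutFn (fun _ => ones a) (dropFn ∘ fanoutFn (fun _ => [true]) logFn)

/-- `nOfU a ∈ FP`. [folklore] -/
theorem nOfU_mem_FP : nOfU a ∈ FP :=
  comp_mem_FP fstF_mem_FP (comp_mem_FP divModFn_mem_FP (fanoutFn_mem_FP (const_mem_FP _)
    (comp_mem_FP dropFn_mem_FP (fanoutFn_mem_FP (const_mem_FP _) logFn_mem_FP))))

/-- `(1ᵏ).drop 1 = 1^{k-1}`. [folklore] -/
theorem ones_drop_one (k : ℕ) : (ones k).drop 1 = ones (k - 1) := by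
  cases k with
  | zero => rfl
  | succ k => simp [ones, List.replicate_succ]

/-- Value of `nOfU`. [folklore] -/
theorem nOfU_apply (u : List Bool) : nOfU a u = ones ((Nat.log 2 u.length - 1) / a) := by
  simp only [nOfU, Function.comp_apply, fanoutFn_apply, logFn]
  rw [show dropFn (boolPair [true] (ones (Nat.log 2 u.length))) = ones (Nat.log 2 u.length - 1) by
    rw [dropFn_boolPair, List.length_singleton, ones_drop_one], divModFn_boolPair, fstF_boolPair]

/-- The payload selector of the sampler: `⟨u, r⟩ ↦ r ↾ ((⌊log₂ |u|⌋ - 1) / a)`. [folklore] -/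
def selF : List Bool → List Bool := takeFn ∘ fanoutFn (nOfU a ∘ fstF) sndF

/-- `selF a ∈ FP`. [folklore] -/
theorem selF_mem_FP : selF a ∈ FP :=
  comp_mem_FP takeFn_mem_FP (fanoutFn_mem_FP (comp_mem_FP (nOfU_mem_FP a) fstF_mem_FP) sndF_mem_FP)

/-- Value of the selector on a pair. [folklore] -/
theorem selF_boolPair (u r : List Bool) :
    selF a (boolPair u r) = r.take ((Nat.log 2 u.length - 1) / a) := by
  simp [selF, Function.comp_apply, fanoutFn_apply, nOfU_apply, ones]

/-- The selected payload is logarithmically short: `|selF a z| ≤ log₂ |z| + 1`. [folklore] -/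
theorem length_selF_le (z : List Bool) : (selF a z).length ≤ Nat.log 2 z.length + 1 := by
  have h1 : (selF a z).length ≤ (nOfU a (fstF z)).length := by
    simp only [selF, Function.comp_apply, fanoutFn_apply, takeFn_boolPair]
    exact List.length_take_le _ _
  rw [nOfU_apply] at h1
  have h2 : (fstF z).length ≤ z.length := length_boolUnpair_fst_le z
  have h3 : Nat.log 2 (fstF z).length ≤ Nat.log 2 z.length := Nat.log_mono_right h2
  have h4 : (Nat.log 2 (fstF z).length - 1) / a ≤ Nat.log 2 (fstF z).length - 1 := Nat.div_le_self _ _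
  simp only [ones, List.length_replicate] at h1
  omega

/-- **The sampler's string function** `⟨u, r⟩ ↦ lpad a (r ↾ ((⌊log₂|u|⌋ - 1)/a))`: the pad of a
uniformly random payload of the length encoded by `|u|`. [folklore] -/
def sampF : List Bool → List Bool := lpad a ∘ selF a

/-- **`sampF a ∈ FP`**: the `2^{O(n)}`-time pad (`lpad_mem_FE`) runs on a logarithmically short
word (`length_selF_le`; sequential composition `TimeComputable.comp_holds`, as for
`lpad_comp_logTruncFn_mem_FP`). [cite: AroraBarakCC2009, §1.3 (Claim 1.6)] -/
theorem sampF_mem_FP : sampF a ∈ FP := by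
  obtain ⟨c, K, hK⟩ := mem_FE_iff.1 (lpad_mem_FE a)
  obtain ⟨p, hp⟩ := selF_mem_FP a
  obtain ⟨C, hC⟩ := TimeComputable.comp_holds hK hp (monotone_expLin c K)
    (s := fun N => Nat.log 2 N + 1) (length_selF_le a)
  refine ⟨Polynomial.C C * (p + (Polynomial.C K * (2 * X + 2) ^ c + Polynomial.C K) + (X + 1)) +
    Polynomial.C C, hC.mono fun N => ?_⟩
  have h1 := two_pow_mul_log_succ_le c N
  have h2 : Nat.log 2 N ≤ N := Nat.log_le_self 2 N
  simp only [eval_add, eval_mul, eval_C, eval_X, eval_pow, eval_ofNat, eval_one]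
  gcongr

/-- **The sampler** (tree `RandAlg`, input `1ᴺ`, `N` coins): output `lpad a (r ↾ n)` with
`n = (⌊log₂ N⌋ - 1)/a`, i.e. the pad of a uniformly random payload of the length `n` that pads to
length `N` (Ben-David–Chor–Goldreich–Luby: the uniform distribution on the instances of one length
of a padded/tally `NE` language is polynomial-time samplable). [cite: BuhrmanFortnowPavan2004, Thm. 3.5 (proof idea)] -/
def sampler : RandAlg ℕ (List Bool) :=
  ⟨fun N r => sampF a (boolPair (unaryEncodeNat N) r), fun n => n⟩

/-- The sampler's output on `1ᴺ` with coins `r`. [folklore] -/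
theorem sampler_run (N : ℕ) (r : List Bool) :
    (sampler a).run N r = lpad a (r.take ((Nat.log 2 N - 1) / a)) := by
  show sampF a (boolPair (unaryEncodeNat N) r) = _
  rw [sampF, Function.comp_apply, selF_boolPair]
  rw [show (unaryEncodeNat N).length = N from unary_decode_encode_nat N]

/-- The sampler is probabilistic polynomial-time. [folklore] -/
theorem sampler_isPolyTime : (sampler a).IsPolyTime unaryEncodeNat id := by
  obtain ⟨p, M, hM⟩ := sampF_mem_FP a
  refine ⟨⟨p, M, fun q => ?_⟩, X, fun n => by simp [sampler]⟩
  obtain ⟨N, r⟩ := q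
  exact hM (boolPair (unaryEncodeNat N) r)

/-- **The pad ensemble** `D^{(a)}`: `D_N` is the output distribution of the sampler on `1ᴺ`
(for `N = |lpad a x|`, `|x| = n ≥ 4`: the pads of the uniformly random payloads of length `n`).
[cite: BuhrmanFortnowPavan2004, Thm. 3.5 (proof idea: "a μ′ that puts enough measure on the tally strings")] -/
def padEnsemble : Ensemble := fun N => (sampler a).outputPMF unaryEncodeNat N

/-- `D^{(a)} ∈ PSamp` (it is the output ensemble of a probabilistic polynomial-time sampler).
[cite: BogdanovTrevisan2006, Def. 2.1] -/
theorem padEnsemble_mem_PSamp : padEnsemble a ∈ PSamp :=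
  ⟨sampler a, sampler_isPolyTime a, fun _ => rfl⟩

variable {a}

/-- `lpad a` is injective (the payload is its second component). [folklore] -/
theorem lpad_injective : Function.Injective (lpad a) := fun x y h => by
  have := congrArg (fun w => (boolUnpair w).2) h
  simpa only [boolUnpair_lpad_snd] using this

/-- `4k < 2^{k+1}` for `4 ≤ k`. [folklore] -/
theorem four_mul_lt_two_pow_succ {k : ℕ} (hk : 4 ≤ k) : 4 * k < 2 ^ (k + 1) := by
  induction k, hk using Nat.le_induction with
  | base => norm_num
  | succ k hk ih =>
    have h4 : 4 ≤ 2 ^ (k + 1) :=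
      calc 4 = 2 ^ 2 := by norm_num
        _ ≤ 2 ^ (k + 1) := Nat.pow_le_pow_right (by norm_num) (by omega)
    calc 4 * (k + 1) = 4 * k + 4 := by ring
      _ < 2 ^ (k + 1) + 2 ^ (k + 1) := by omega
      _ = 2 ^ (k + 1 + 1) := by ring

/-- **The pad length determines the payload length**: `⌊log₂ |lpad a x|⌋ = a|x| + 1`, hence
`(⌊log₂ |lpad a x|⌋ - 1) / a = |x|`, for `1 ≤ a` and `|x| ≥ 4`. [folklore] -/
theorem nOf_length_lpad (ha : 1 ≤ a) {x : List Bool} (hx : 4 ≤ x.length) :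
    (Nat.log 2 (lpad a x).length - 1) / a = x.length := by
  set n := x.length with hn
  set k := a * n with hk
  have hk4 : 4 ≤ k := le_trans hx (by rw [hk]; exact Nat.le_mul_of_pos_left n ha)
  have hnk : n ≤ k := by rw [hk]; exact Nat.le_mul_of_pos_left n ha
  have hlen : (lpad a x).length = 2 ^ (k + 1) + (2 * k + 4 + n) := by
    rw [length_lpad, ← hn, ← hk, pow_succ]; ring
  have hlog : Nat.log 2 (lpad a x).length = k + 1 := by
    rw [hlen]
    refine Nat.log_eq_of_pow_le_of_lt_pow ?_ ?_
    · exact Nat.le_add_right _ _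
    · have := four_mul_lt_two_pow_succ hk4
      rw [pow_succ 2 (k + 1)]
      omega
  rw [hlog, Nat.add_sub_cancel, hk, Nat.mul_div_cancel_left n ha]

/-- The payload is not longer than the pad. [folklore] -/
theorem length_le_length_lpad (x : List Bool) : x.length ≤ (lpad a x).length := by
  rw [length_lpad]; omega

/-- **Each pad of a payload of length `n ≥ 4` has probability `2⁻ⁿ` under `D_N`, `N` its length.**
[cite: BuhrmanFortnowPavan2004, Thm. 3.5 (proof idea)] -/
theorem prob_padEnsemble_lpad (ha : 1 ≤ a) {x : List Bool} (hx : 4 ≤ x.length) :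
    (padEnsemble a).prob (lpad a x).length {lpad a x} = 1 / 2 ^ x.length := by
  have hn := nOf_length_lpad ha hx
  show (sampler a).pr unaryEncodeNat (lpad a x).length {lpad a x} = _
  rw [RandAlg.pr_eq_uniformProb]
  have hcoin : (sampler a).coinLen (unaryEncodeNat (lpad a x).length).length = (lpad a x).length :=
    unary_decode_encode_nat _
  rw [hcoin]
  have hset : {y : List Bool | (sampler a).run (lpad a x).length y ∈ ({lpad a x} : Set (List Bool))} =
      {y : List Bool | y.take x.length ∈ ({x} : Set (List Bool))} := by
    ext y
    simp only [Set.mem_setOf_eq, Set.mem_singleton_iff, sampler_run, hn]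
    exact ⟨fun h => lpad_injective h, fun h => by rw [h]⟩
  rw [hset, uniformProb_take_of_le (length_le_length_lpad x), uniformProb_eq_cnt_div, ToranCH.cnt_singleton]
  simp

/-- Pads of payloads of length `≥ 4` lie in the support of `D_N`, `N` their length. [folklore] -/
theorem lpad_mem_support (ha : 1 ≤ a) {x : List Bool} (hx : 4 ≤ x.length) :
    lpad a x ∈ (padEnsemble a (lpad a x).length).support := by
  rw [PMF.mem_support_iff]
  intro h0
  have h := prob_padEnsemble_lpad ha hx
  unfold Ensemble.prob at h
  rw [PMF.toOuterMeasure_apply_singleton, h0, ENNReal.toReal_zero] at h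
  have : (0 : ℝ) < 1 / 2 ^ x.length := by positivity
  linarith

end Sampler

/-! ### C. Under `DistNP ⊆ AvgP` the pads of long payloads are decided in polynomial time -/

section Decide

variable (a : ℕ)

/-- The error parameter `m(w) = 2^{n+1}`, `n = (⌊log₂|w|⌋ - 1)/a` the payload length encoded by
`|w|`: an errorless heuristic scheme with failure probability `≤ 1/m(w) < 2⁻ⁿ` cannot fail on a pad
of probability `2⁻ⁿ`. [cite: BuhrmanFortnowPavan2004, Thm. 3.5 (proof idea)] -/
def mOf (w : List Bool) : ℕ := 2 ^ ((Nat.log 2 w.length - 1) / a + 1)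

/-- `m(w) ≤ 2|w| + 2`. [folklore] -/
theorem mOf_le (w : List Bool) : mOf a w ≤ 2 * w.length + 2 := by
  unfold mOf
  have h1 : (Nat.log 2 w.length - 1) / a + 1 ≤ Nat.log 2 w.length + 1 := by
    have := Nat.div_le_self (Nat.log 2 w.length - 1) a
    omega
  exact (Nat.pow_le_pow_right Nat.two_pos h1).trans (two_pow_log_succ_le w.length)

/-- The error parameter in unary, `w ↦ 1^{m(w)}` (capped binary-to-unary conversion of the numeral
`0^{n+1} 1`; the cap `2|w| + 2` never bites). [folklore] -/
def mF : List Bool → List Bool :=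
  binToUnaryFn ∘ fanoutFn (polyFn (2 * X + 2)) (pow2NumF 1 ∘ List.cons true ∘ nOfU a)

/-- `mF a ∈ FP`. [folklore] -/
theorem mF_mem_FP : mF a ∈ FP :=
  comp_mem_FP binToUnaryFn_mem_FP (fanoutFn_mem_FP (polyFn_mem_FP _)
    (comp_mem_FP (pow2NumF_mem_FP 1) (comp_mem_FP (cons_mem_FP true) (nOfU_mem_FP a))))

/-- Value of `mF`: `1^{m(w)}`. [folklore] -/
theorem mF_apply (w : List Bool) : mF a w = ones (mOf a w) := by
  have hmin : min (mOf a w) (2 * w.length + 2) = mOf a w := min_eq_left (mOf_le a w)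
  simp only [mF, Function.comp_apply, fanoutFn_apply, polyFn_apply, binToUnaryFn_boolPair,
    bitsToNat_pow2NumF, List.length_cons, nOfU_apply, ones, List.length_replicate, one_mul,
    eval_add, eval_mul, eval_X, eval_ofNat]
  unfold mOf at hmin ⊢
  rw [hmin]

/-- The preprocessing `w ↦ ⟨w, ⟨1^{|w|}, 1^{m(w)}⟩⟩` of the decider (the instance, the ensemble index
`N = |w|` and the error parameter, in the input format `schemeEnc` of errorless heuristic schemes).
[folklore] -/
def preF : List Bool → List Bool := fanoutFn (fun w => w) (fanoutFn (polyFn X) (mF a))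

/-- `preF a ∈ FP`. [folklore] -/
theorem preF_mem_FP : preF a ∈ FP :=
  fanoutFn_mem_FP OracleCompose.id_mem_FP (fanoutFn_mem_FP (polyFn_mem_FP _) (mF_mem_FP a))

/-- Value of the preprocessing: `schemeEnc (w, |w|, m(w))`. [folklore] -/
theorem preF_apply (w : List Bool) : preF a w = schemeEnc (w, w.length, mOf a w) := by
  simp only [preF, fanoutFn_apply, polyFn_apply, eval_X, mF_apply, schemeEnc,
    unaryEncodeNat_eq_replicate, ones]

/-- The preprocessing is polynomial-time from `id` to `schemeEnc`. [folklore] -/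
theorem polyTimeComputable_pre :
    PolyTimeComputable (id : List Bool → List Bool) schemeEnc fun w => (w, w.length, mOf a w) := by
  obtain ⟨p, M, hM⟩ := preF_mem_FP a
  refine ⟨p, M, fun w => ?_⟩
  have h := hM w
  rw [show (id (preF a w) : List Bool) = preF a w from rfl, preF_apply] at h
  exact h

variable {a}

/-- **The polynomial-time language cut out by an errorless heuristic scheme** run at index `|w|`
and error parameter `m(w)`: `{w | A(w, 1^{|w|}, 1^{m(w)}) = 1} ∈ P`.
[cite: BogdanovTrevisan2006, Def. 2.4] -/
theorem setOf_scheme_accepts_mem_P {A : List Bool → ℕ → ℕ → Option Bool}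
    (hA : PolyTimeComputable schemeEnc optBoolEnc fun q : List Bool × ℕ × ℕ => A q.1 q.2.1 q.2.2) :
    ({w | A w w.length (mOf a w) = some true} : Language Bool) ∈ Classes.P := by
  have hcomp := PolyTimeComputable.comp_holds hA (polyTimeComputable_pre a)
  have hFP : (fun w => optBoolEnc (A w w.length (mOf a w))) ∈ FP := by
    obtain ⟨p, M, hM⟩ := hcomp
    exact ⟨p, M, fun w => hM w⟩
  have h := setOf_apply_eq_apply_mem_P hFP (const_mem_FP (optBoolEnc (some true)))
  have hset : ({w | A w w.length (mOf a w) = some true} : Language Bool) =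
      {w | optBoolEnc (A w w.length (mOf a w)) = (fun _ : List Bool => optBoolEnc (some true)) w} := by
    ext w
    exact ⟨fun hw => congrArg optBoolEnc hw, fun hw => (encodingBoolBool.optionBool).encode_injective hw⟩
  rw [hset]
  exact h

end Decide

/-! ### D. `NTIME(2^{an}) ⊆ E` under `DistNP ⊆ AvgP` -/

section Assembly

variable {a : ℕ}

/-- The pad length as a function of the payload length. [folklore] -/
theorem length_lpad_eq (a : ℕ) (x : List Bool) :
    (lpad a x).length = (fun n : ℕ => 2 * (2 ^ (a * n) + a * n + 1) + 2 + n) x.length :=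
  length_lpad a x

/-- The pad length is strictly monotone in the payload length. [folklore] -/
theorem strictMono_length_lpad (a : ℕ) :
    StrictMono fun n : ℕ => 2 * (2 ^ (a * n) + a * n + 1) + 2 + n := by
  refine strictMono_nat_of_lt_succ fun n => ?_
  have h1 : 2 ^ (a * n) ≤ 2 ^ (a * (n + 1)) := Nat.pow_le_pow_right Nat.two_pos (by nlinarith)
  have h2 : a * n ≤ a * (n + 1) := by nlinarith
  show 2 * (2 ^ (a * n) + a * n + 1) + 2 + n < 2 * (2 ^ (a * (n + 1)) + a * (n + 1) + 1) + 2 + (n + 1)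
  omega

end Assembly

end AvgNE

open AvgNE

section Main

variable {a : ℕ}

/-- **Ben-David–Chor–Goldreich–Luby: if `NP` is easy on average then `NTIME(2^{an}) ⊆ E`** (`1 ≤ a`;
Buhrman–Fortnow–Pavan 2005, Thm. 3.5: "If NP is easy on average then `E = NE`", with the proof
idea printed there: a samplable ensemble puts enough measure on the (padded) tally strings that an
algorithm polynomial on average must be polynomial on all of them, so the padded `NE` language is in
`P`, which translates upward). Proof: for `L ∈ NTIME(2^{an})` the pads `lpad a x`, `x ∈ L`, form an
`NP` language `L♯` (`exists_pad_mem_NP`); the pad ensemble `D^{(a)}` (`padEnsemble_mem_PSamp`) gives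
every pad of a payload of length `n ≥ 4` probability `2⁻ⁿ` at its own length (`prob_padEnsemble_lpad`),
so the errorless heuristic scheme of `(L♯, D^{(a)}) ∈ DistNP ⊆ AvgP`, run with error parameter
`2^{n+1}`, never fails on such a pad and answers `[lpad a x ∈ L♯] = [x ∈ L]`; this is a polynomial-time
language of pads (`setOf_scheme_accepts_mem_P`), patched on the finitely many short payload lengths,
whose preimage under the `2^{O(n)}`-time pad is `L ∈ E` (`preimage_mem_E`).
[cite: BuhrmanFortnowPavan2004, Thm. 3.5] -/
theorem NTIME_two_pow_mul_subset_E_of_DistNP_subset_AvgP (hD : DistNP ⊆ AvgP) (ha : 1 ≤ a) :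
    NTIME (fun n => 2 ^ (a * n)) ⊆ E := by
  intro L hL
  obtain ⟨Lp, hLpNP, hiff, -⟩ := exists_pad_mem_NP ha hL
  have hDist : (⟨Lp, padEnsemble a⟩ : DistProblem) ∈ DistNP := ⟨hLpNP, padEnsemble_mem_PSamp a⟩
  obtain ⟨A, hA, herr, hfail⟩ := hD hDist
  -- the polynomial-time language of pads accepted by the scheme
  have hLqP : ({w | A w w.length (mOf a w) = some true} : Language Bool) ∈ Classes.P :=
    setOf_scheme_accepts_mem_P hA
  -- correctness on pads of long payloads
  have key : ∀ x : List Bool, 4 ≤ x.length →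
      (x ∈ L ↔ lpad a x ∈ ({w | A w w.length (mOf a w) = some true} : Language Bool)) := by
    intro x hx
    have hn : (Nat.log 2 (lpad a x).length - 1) / a = x.length := nOf_length_lpad ha hx
    have hm : mOf a (lpad a x) = 2 ^ (x.length + 1) := by simp only [mOf, hn]
    -- the scheme does not fail on the pad
    have hsome : A (lpad a x) (lpad a x).length (mOf a (lpad a x)) ≠ none := by
      intro hnone
      have h1 := hfail (lpad a x).length (mOf a (lpad a x)) (by unfold mOf; exact Nat.two_pow_pos _)
      have h2 : (padEnsemble a).prob (lpad a x).length {lpad a x} ≤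
          (padEnsemble a).prob (lpad a x).length
            {v | A v (lpad a x).length (mOf a (lpad a x)) = none} :=
        Ensemble.prob_mono _ _ fun v hv => by
          obtain ⟨hv, -⟩ := hv
          rw [Set.mem_singleton_iff.1 hv]
          exact hnone
      rw [prob_padEnsemble_lpad ha hx] at h2
      have h3 := h2.trans h1
      rw [hm] at h3
      push_cast at h3
      rw [div_le_div_iff_of_pos_left one_pos (by positivity) (by positivity), pow_succ] at h3
      have h4 : (0 : ℝ) < 2 ^ x.length := by positivity
      linarith
    obtain ⟨b, hb⟩ := Option.ne_none_iff_exists'.1 hsome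
    have hb' : b = Lp.boolIndicator (lpad a x) :=
      herr (mOf a (lpad a x)) (lpad a x).length (lpad a x) (lpad_mem_support ha hx) b hb
    rw [hiff x]
    show lpad a x ∈ Lp ↔ A (lpad a x) (lpad a x).length (mOf a (lpad a x)) = some true
    rw [hb, hb']
    constructor
    · intro hw
      rw [(Set.mem_iff_boolIndicator _ _).1 hw]
    · intro h
      exact (Set.mem_iff_boolIndicator _ _).2 (Option.some_injective _ h)
  -- patching the short payloads at the level of pads
  set N₄ : ℕ := 2 * (2 ^ (a * 4) + a * 4 + 1) + 2 + 4 with hN₄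
  have hlt4 : ∀ x : List Bool, (lpad a x).length < N₄ ↔ x.length < 4 := fun x => by
    rw [length_lpad_eq, hN₄]
    exact (strictMono_length_lpad a).lt_iff_lt
  have hLge : ({w | N₄ ≤ w.length} : Language Bool) ∈ Classes.P := by
    have h := Kannan.setOf_length_le_mem_P OracleCompose.id_mem_FP (const_mem_FP (ones N₄)) X
    have hset : ({w | N₄ ≤ w.length} : Language Bool) =
        {w | ((fun _ : List Bool => ones N₄) w).length ≤ X.eval ((id w : List Bool)).length} := by
      ext w
      simp [ones]
    rw [hset]
    exact h
  have hLfix : ({w | w.length < N₄ ∧ logTruncFn w ∈ L} : Language Bool) ∈ Classes.P := by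
    let g : List Bool → List Bool := fun z =>
      if z.length < N₄ then [L.boolIndicator (logTruncFn z)] else [false]
    have hg : g ∈ FP :=
      mem_FP_of_eqOn_le (const_mem_FP [false]) N₄ fun z hz => by simp only [g, if_neg (not_lt.2 hz)]
    refine mem_P_of_mem_FP hg _ fun w => ⟨fun hw => ?_, fun hw => ?_⟩
    · obtain ⟨h1, h2⟩ := hw
      simp only [g, if_pos h1, (Set.mem_iff_boolIndicator _ _).1 h2]
    · by_cases h1 : w.length < N₄
      · have h2 : logTruncFn w ∉ L := fun h2 => hw ⟨h1, h2⟩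
        simp only [g, if_pos h1, (Set.notMem_iff_boolIndicator _ _).1 h2]
      · simp only [g, if_neg h1]
  have hLall : (({w | A w w.length (mOf a w) = some true} ⊓ {w | N₄ ≤ w.length}) ⊔
      {w | w.length < N₄ ∧ logTruncFn w ∈ L} : Language Bool) ∈ Classes.P :=
    union_mem_P (inter_mem_P hLqP hLge) hLfix
  -- `L` is the preimage of the patched language under the pad
  have hpre : L = lpad a ⁻¹' ((({w | A w w.length (mOf a w) = some true} ⊓ {w | N₄ ≤ w.length}) ⊔
      {w | w.length < N₄ ∧ logTruncFn w ∈ L} : Language Bool) : Set (List Bool)) := by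
    ext x
    change x ∈ L ↔ (lpad a x ∈ ({w | A w w.length (mOf a w) = some true} : Language Bool) ∧
      N₄ ≤ (lpad a x).length) ∨ ((lpad a x).length < N₄ ∧ logTruncFn (lpad a x) ∈ L)
    rw [logTruncFn_lpad ha]
    by_cases hx : x.length < 4
    · have h1 : (lpad a x).length < N₄ := (hlt4 x).2 hx
      constructor
      · exact fun h => Or.inr ⟨h1, h⟩
      · rintro (⟨-, h⟩ | ⟨-, h⟩)
        · omega
        · exact h
    · have hx' : 4 ≤ x.length := not_lt.1 hx
      have h1 : N₄ ≤ (lpad a x).length := not_lt.1 fun h => hx ((hlt4 x).1 h)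
      rw [key x hx']
      constructor
      · exact fun h => Or.inl ⟨h, h1⟩
      · rintro (⟨h, -⟩ | ⟨h, -⟩)
        · exact h
        · omega
  rw [hpre]
  exact preimage_mem_E (lpad_mem_FE a) hLall

end Main

section Collapse

/-! ### E. `NE = E` under `DistNP ⊆ AvgP` -/

/-- **`NTIME(1) ⊆ NTIME(2ⁿ)`** in the tree's one-constant verifier form (the member `c = 0` of the
union `NE = ⋃_c NTIME(2^{cn})`): the verifier of the larger class must be specified on all
witnesses of length `≤ c'·2ⁿ + c'`, so the given verifier `M` (specified on witnesses of length
`≤ 2c` only) is preceded by the truncating wrapper `truncMapAux` of `TruncMapMachine.lean` for the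
constant clock `x ↦ ⟨x, 1^{2c}⟩`, which cuts the witness to length `2c` and reads the rest two
symbols per step. [cite: AroraBarakCC2009, §2.1.2 (Def. 2.1, NTIME)] -/
theorem NTIME_one_subset_NTIME_two_pow :
    NTIME (fun n => 2 ^ (0 * n)) ⊆ NTIME (fun n => 2 ^ (1 * n)) := by
  intro L hL
  obtain ⟨c, R, M, hM, hLR⟩ := hL
  simp only [Nat.zero_mul, pow_zero, mul_one] at hM hLR
  obtain ⟨q, Nc, hNc⟩ := (fanoutFn_mem_FP OracleCompose.id_mem_FP (const_mem_FP (ones (c + c))) :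
    (fanoutFn (id : List Bool → List Bool) fun _ => ones (c + c)) ∈ FP)
  obtain ⟨b, hb⟩ := TimeConstructible.exists_poly_le_two_pow_pow
    (q + 5 * X + Polynomial.C (3 * (c + c) + 11)) le_rfl
  refine ⟨2 * b + 2, fun x y => R x (y.take (c + c)), (truncMapAux Nc).comp M,
    fun x y hy => ?_, fun x => ?_⟩
  · -- running time
    have hclock : Nc.OutputsWithin x (boolPair x (ones (c + c))) (q.eval x.length) := by
      have h := hNc x
      simpa [fanoutFn_apply] using h
    have h₁ := outputsWithin_truncMapAux_boolPair Nc (y := y) hclock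
    simp only [ones, List.length_replicate] at h₁
    have hy' : (y.take (c + c)).length ≤ c + c := List.length_take_le _ _
    have h₂ := hM x (y.take (c + c)) hy'
    have h := TM2ComputableAux.comp_outputsWithin _ _ h₁ h₂
    refine h.mono ?_
    simp only [Nat.one_mul] at hy ⊢
    have hbx := hb x.length
    simp only [eval_add, eval_mul, eval_X, eval_C, eval_ofNat, pow_one] at hbx
    have hy2 : 2 * (y.length / 2) ≤ y.length := Nat.mul_div_le y.length 2
    have e : (2 * b + 2) * 2 ^ x.length + (2 * b + 2) =
        2 * (b * 2 ^ x.length) + 2 * 2 ^ x.length + 2 * b + 2 := by ring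
    rw [e] at hy ⊢
    set B := b * 2 ^ x.length with hB
    set P := 2 ^ x.length with hP
    have hP1 : 1 ≤ P := Nat.one_le_two_pow
    omega
  · -- correctness
    rw [hLR x]
    simp only [Nat.one_mul]
    constructor
    · rintro ⟨y₀, hy₀, hR⟩
      refine ⟨y₀, ?_, ?_⟩
      · have hbx := hb x.length
        simp only [eval_add, eval_mul, eval_X, eval_C, eval_ofNat, pow_one] at hbx
        have e : (2 * b + 2) * 2 ^ x.length + (2 * b + 2) =
            2 * (b * 2 ^ x.length) + 2 * 2 ^ x.length + 2 * b + 2 := by ring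
        rw [e]
        set B := b * 2 ^ x.length with hB
        omega
      · show R x (y₀.take (c + c)) = true
        rwa [List.take_of_length_le hy₀]
    · rintro ⟨y, -, hR⟩
      exact ⟨y.take (c + c), List.length_take_le _ _, hR⟩

/-- **Buhrman–Fortnow–Pavan, Thm. 3.5 (Ben-David–Chor–Goldreich–Luby 1992): if `NP` is easy on
average (`DistNP ⊆ AvgP`) then `NE ⊆ E`.** (`NTIME_two_pow_mul_subset_E_of_DistNP_subset_AvgP` for
each exponent `a ≥ 1`; the member `a = 0` of the union through `NTIME_one_subset_NTIME_two_pow`.)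
[cite: BuhrmanFortnowPavan2004, Thm. 3.5] -/
theorem NE_subset_E_of_DistNP_subset_AvgP (hD : DistNP ⊆ AvgP) : NE ⊆ E := by
  intro L hL
  simp only [NE, Set.mem_iUnion] at hL
  obtain ⟨c, hc⟩ := hL
  rcases Nat.eq_zero_or_pos c with rfl | hpos
  · exact NTIME_two_pow_mul_subset_E_of_DistNP_subset_AvgP hD le_rfl (NTIME_one_subset_NTIME_two_pow hc)
  · exact NTIME_two_pow_mul_subset_E_of_DistNP_subset_AvgP hD hpos hc

/-- **`E ⊆ NE`** (deterministic time is nondeterministic time, Arora–Barak 2009, Claim 2.4, at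
linear-exponential scale: `DTIME(2^{cn}) ⊆ NTIME(2^{cn})` for `c ≥ 1` by
`DTIME_subset_NTIME_of_dominated`, and `DTIME(1) ⊆ DTIME(2ⁿ)`). [cite: AroraBarakCC2009, Claim 2.4] -/
theorem E_subset_NE : E ⊆ NE := by
  intro L hL
  simp only [E, Set.mem_iUnion] at hL
  obtain ⟨c, hc⟩ := hL
  -- move to an exponent `≥ 1`
  have hc' : L ∈ DTIME fun n => 2 ^ (max c 1 * n) := by
    obtain ⟨a, ha⟩ := hc
    refine ⟨a, timeClass_mono (fun n => ?_) ha⟩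
    have : 2 ^ (c * n) ≤ 2 ^ (max c 1 * n) :=
      Nat.pow_le_pow_right Nat.two_pos (Nat.mul_le_mul_right n (le_max_left c 1))
    exact Nat.add_le_add_right (Nat.mul_le_mul_left a this) a
  simp only [NE, Set.mem_iUnion]
  refine ⟨max c 1, DTIME_subset_NTIME_of_dominated (fun a p => ?_) hc'⟩
  obtain ⟨b, hb⟩ := TimeConstructible.exists_poly_le_two_pow_pow p le_rfl
  refine ⟨b + a, fun n => ?_⟩
  have h1 := hb n
  simp only [pow_one] at h1
  have h2 : 2 ^ n ≤ 2 ^ (max c 1 * n) :=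
    Nat.pow_le_pow_right Nat.two_pos (Nat.le_mul_of_pos_left n (lt_max_of_lt_right Nat.one_pos))
  nlinarith [h1, h2, Nat.one_le_two_pow (n := max c 1 * n)]

/-- **Buhrman–Fortnow–Pavan, Thm. 3.5 as printed: if `NP` is easy on average then `E = NE`.**
[cite: BuhrmanFortnowPavan2004, Thm. 3.5] -/
theorem E_eq_NE_of_DistNP_subset_AvgP (hD : DistNP ⊆ AvgP) : E = NE :=
  Set.Subset.antisymm E_subset_NE (NE_subset_E_of_DistNP_subset_AvgP hD)

end Collapse

end Literature.Computability.MetaComplexity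

end
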